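import Mathlib.MeasureTheory.Function.ConvergenceInDistribution
import Literature.Probability.Process.PathSpaceModulus
import Mathlib.Topology.ContinuousMap.SecondCountableSpace
import Mathlib.Topology.Metrizable.ContinuousMap
import Mathlib.Topology.UniformSpace.CompactConvergence
import Mathlib.Topology.MetricSpace.UniformConvergence
import HarnessLib

/-!
# Convergence in distribution in `C([0, ∞), F)` from couplings that are uniformly close on compacts

The form in which driving-process convergence is PROVED in the literature on lattice models is
a coupling statement, e.g. Lawler–Schramm–Werner (2004), Thm. 4.4 (p. 976): "there is a coupling
of standard Brownian motion `B` and `W` such that `P[sup{|W(t) - B(8t)| : t ∈ [0, T]} > ε₂] < ε₃`"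
for all large `R`; the form in which it is USED (ibid., proof of Thm. 4.7, p. 981: "Theorem 4.4
implies that the law of `W` converges weakly to the law of `B(8t)`") is weak convergence of the
laws on the path space `C([0, ∞))` with the topology of locally uniform convergence. This file
proves that implication in general:

* `Literature.Probability.Process.tendstoInDistribution_of_coupling` — if for every horizon `T`,
  `ε > 0`, `η > 0`, eventually in `n` there is a coupling `ρ` of the laws of `Yₙ` and `Z` (a
  measure on `C × C` with these marginals) with `ρ[∃ t ≤ T, ε ≤ dist (y t) (z t)] ≤ η`, then
  `Yₙ → Z` in distribution (Mathlib `TendstoInDistribution`).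

Proof: portmanteau through closed sets (Mathlib `tendsto_of_forall_isClosed_limsup_le'`): for
`G` closed, `law(Yₙ)(G) ≤ law(Z)(N_k(G)) + η` eventually, where
`N_k(G) = {y | ∃ z ∈ G, ∀ t ≤ k+1, dist (y t) (z t) < 1/(k+1)}` is open (`isOpen_tubeNhd`) and
decreases to `G` as `k → ∞` (`iInter_tubeNhd_subset`), because the tubes
`{y | ∀ t ≤ T, dist (y t) (z t) < ε}` form neighbourhood bases of the compact-open topology.

## References

* G. F. Lawler, O. Schramm, W. Werner, Ann. Probab. 32 (2004), Thm. 4.4 and proof of Thm. 4.7.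
* P. Billingsley, *Convergence of Probability Measures* (2nd ed. 1999), Thm. 2.1 (portmanteau)
  and Thm. 3.1 (convergence from closeness in probability under a coupling).
-/

noncomputable section

open Set Filter Topology Metric MeasureTheory
open scoped NNReal ENNReal

namespace Literature.Probability.Process

variable {F : Type*} [PseudoMetricSpace F]

/-! ### Tubes: the neighbourhood basis of locally uniform convergence -/

/-- The **tube** of horizon `T` and width `ε` about the path `z`: paths `y` with
`dist (y t) (z t) < ε` for all `t ≤ T`. [folklore] -/
def tube (z : C(ℝ≥0, F)) (T ε : ℝ) : Set C(ℝ≥0, F) :=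
  {y | ∀ t : ℝ≥0, (t : ℝ) ≤ T → dist (y t) (z t) < ε}

/-- Membership in a tube. [folklore] -/
theorem mem_tube {z y : C(ℝ≥0, F)} {T ε : ℝ} :
    y ∈ tube z T ε ↔ ∀ t : ℝ≥0, (t : ℝ) ≤ T → dist (y t) (z t) < ε := Iff.rfl

/-- A path is in its own tubes of positive width. [folklore] -/
theorem self_mem_tube (z : C(ℝ≥0, F)) (T : ℝ) {ε : ℝ} (hε : 0 < ε) : z ∈ tube z T ε :=
  fun t _ ↦ by rwa [dist_self]

/-- **Tubes are neighbourhoods** in the compact-open topology (a basic entourage of the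
uniformity of compact convergence over the compact time set `[0, T]`). [folklore] -/
theorem tube_mem_nhds (z : C(ℝ≥0, F)) (T : ℝ) {ε : ℝ} (hε : 0 < ε) : tube z T ε ∈ 𝓝 z := by
  have hV : {fg : C(ℝ≥0, F) × C(ℝ≥0, F) | ∀ x ∈ {s : ℝ≥0 | (s : ℝ) ≤ T},
      (fg.1 x, fg.2 x) ∈ {p : F × F | dist p.1 p.2 < ε}} ∈ uniformity C(ℝ≥0, F) :=
    ContinuousMap.hasBasis_compactConvergenceUniformity.mem_of_mem
      (i := ⟨{s : ℝ≥0 | (s : ℝ) ≤ T}, {p : F × F | dist p.1 p.2 < ε}⟩)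
      ⟨isCompact_setOf_coe_le T, dist_mem_uniformity hε⟩
  refine mem_of_superset (UniformSpace.ball_mem_nhds z hV) fun y hy t ht ↦ ?_
  rw [dist_comm]
  exact hy t ht

/-- **Tubes are open.** If `y₀ ∈ tube z T ε`, the maximum `m` of `t ↦ dist (y₀ t) (z t)` on the
compact `[0, T]` is `< ε`, and `tube y₀ T (ε - m) ⊆ tube z T ε`. [folklore] -/
theorem isOpen_tube (z : C(ℝ≥0, F)) (T ε : ℝ) : IsOpen (tube z T ε) := by
  rw [isOpen_iff_mem_nhds]
  intro y₀ hy₀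
  rcases ({s : ℝ≥0 | (s : ℝ) ≤ T}).eq_empty_or_nonempty with hemp | hne
  · refine mem_of_superset univ_mem fun y _ t ht ↦ ?_
    have : t ∈ {s : ℝ≥0 | (s : ℝ) ≤ T} := ht
    rw [hemp] at this
    exact absurd this (notMem_empty t)
  obtain ⟨t₀, ht₀, hmax⟩ := (isCompact_setOf_coe_le T).exists_isMaxOn hne
    (y₀.continuous.dist z.continuous).continuousOn
  have hm : dist (y₀ t₀) (z t₀) < ε := hy₀ t₀ ht₀
  refine mem_of_superset (tube_mem_nhds y₀ T (sub_pos.2 hm)) fun y hy t ht ↦ ?_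
  calc dist (y t) (z t) ≤ dist (y t) (y₀ t) + dist (y₀ t) (z t) := dist_triangle _ _ _
    _ < (ε - dist (y₀ t₀) (z t₀)) + dist (y₀ t₀) (z t₀) := add_lt_add_of_lt_of_le (hy t ht) (hmax ht)
    _ = ε := sub_add_cancel ε _

/-- The **tube neighbourhood** of a set `G` of paths: `⋃ z ∈ G, tube z T ε`. [folklore] -/
def tubeNhd (G : Set C(ℝ≥0, F)) (T ε : ℝ) : Set C(ℝ≥0, F) :=
  ⋃ z ∈ G, tube z T ε

/-- Membership in a tube neighbourhood. [folklore] -/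
theorem mem_tubeNhd {G : Set C(ℝ≥0, F)} {T ε : ℝ} {y : C(ℝ≥0, F)} :
    y ∈ tubeNhd G T ε ↔ ∃ z ∈ G, y ∈ tube z T ε := by
  simp only [tubeNhd, mem_iUnion, exists_prop]

/-- Tube neighbourhoods are open. [folklore] -/
theorem isOpen_tubeNhd {G : Set C(ℝ≥0, F)} {T ε : ℝ} : IsOpen (tubeNhd G T ε) :=
  isOpen_biUnion fun z _ ↦ isOpen_tube z T ε

/-- A set lies in its tube neighbourhoods of positive width. [folklore] -/
theorem subset_tubeNhd (G : Set C(ℝ≥0, F)) (T : ℝ) {ε : ℝ} (hε : 0 < ε) : G ⊆ tubeNhd G T ε :=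
  fun z hz ↦ mem_tubeNhd.2 ⟨z, hz, self_mem_tube z T hε⟩

/-- Tube neighbourhoods shrink when the horizon grows and the width shrinks. [folklore] -/
theorem tubeNhd_mono (G : Set C(ℝ≥0, F)) {T T' ε ε' : ℝ} (hT : T ≤ T') (hε : ε' ≤ ε) :
    tubeNhd G T' ε' ⊆ tubeNhd G T ε := by
  intro y hy
  obtain ⟨z, hz, hyz⟩ := mem_tubeNhd.1 hy
  exact mem_tubeNhd.2 ⟨z, hz, fun t ht ↦ (hyz t (ht.trans hT)).trans_le hε⟩

/-- **Tube neighbourhoods decrease to the set** when it is closed: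
`⋂ₖ tubeNhd G (k+1) (1/(k+1)) ⊆ G`. A path in all of them is the locally uniform limit of paths
of `G`. [folklore] -/
theorem iInter_tubeNhd_subset {G : Set C(ℝ≥0, F)} (hG : IsClosed G) :
    ⋂ k : ℕ, tubeNhd G ((k : ℝ) + 1) (1 / ((k : ℝ) + 1)) ⊆ G := by
  intro y hy
  rw [mem_iInter] at hy
  choose z hz hyz using fun k ↦ mem_tubeNhd.1 (hy k)
  have hlim : Tendsto z atTop (𝓝 y) := by
    rw [ContinuousMap.tendsto_iff_forall_isCompact_tendstoUniformlyOn]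
    intro K hK
    obtain ⟨b, hb⟩ := hK.bddAbove
    rw [Metric.tendstoUniformlyOn_iff]
    intro δ hδ
    obtain ⟨k₁, hk₁⟩ := exists_nat_ge (b : ℝ)
    obtain ⟨k₂, hk₂⟩ := exists_nat_one_div_lt hδ
    refine eventually_atTop.2 ⟨max k₁ k₂, fun k hk t ht ↦ ?_⟩
    have hk1 : (k₁ : ℝ) ≤ k := by exact_mod_cast le_of_max_le_left hk
    have hk2 : (k₂ : ℝ) ≤ k := by exact_mod_cast le_of_max_le_right hk
    have htb : (t : ℝ) ≤ b := by exact_mod_cast hb ht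
    have h1 : (t : ℝ) ≤ k + 1 := by linarith
    have h2 : 1 / ((k : ℝ) + 1) < δ :=
      lt_of_le_of_lt (one_div_le_one_div_of_le (by positivity) (by linarith)) hk₂
    exact (hyz k t h1).trans h2
  exact hG.mem_of_tendsto hlim (Eventually.of_forall hz)

/-! ### Convergence in distribution from couplings -/

/-- **Convergence in distribution on `C([0, ∞), F)` from couplings uniformly close on compacts**
(the step "[LSW04] Thm. 4.4 ⇒ the law of `W` converges weakly to the law of `B(8t)`", proof of
Thm. 4.7, p. 981; Billingsley (1999), Thm. 3.1 in coupling form). Let `Yₙ : Ωₙ → C(ℝ≥0, F)` and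
`Z : Ω' → C(ℝ≥0, F)` be a.e.-measurable random paths on probability spaces. If for every horizon
`T`, width `ε > 0` and `η > 0`, eventually in `n` there is a measure `ρ` on `C × C` with
marginals the laws of `Yₙ` and `Z` and `ρ[∃ t ≤ T, ε ≤ dist (y t) (z t)] ≤ η`, then `Yₙ → Z` in
distribution. Proof by the closed-set portmanteau criterion: for `G` closed,
`law(Yₙ)(G) ≤ law(Z)(tubeNhd G (k+1) (1/(k+1))) + η` eventually, and the tube neighbourhoods
decrease to `G`. Billingsley (1999), Thm. 3.1; [LSW04] proof of Thm. 4.7 (p. 981).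
[cite: Billingsley1999, Thm. 3.1] -/
theorem tendstoInDistribution_of_coupling [MeasurableSpace C(ℝ≥0, F)]
    [OpensMeasurableSpace C(ℝ≥0, F)]
    {Ω : ℕ → Type*} [∀ n, MeasurableSpace (Ω n)] {P : ∀ n, Measure (Ω n)}
    [∀ n, IsProbabilityMeasure (P n)] {Ω' : Type*} [MeasurableSpace Ω'] {P' : Measure Ω'}
    [IsProbabilityMeasure P'] {Y : ∀ n, Ω n → C(ℝ≥0, F)} {Z : Ω' → C(ℝ≥0, F)}
    (hY : ∀ n, AEMeasurable (Y n) (P n)) (hZ : AEMeasurable Z P')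
    (hcoup : ∀ (T ε : ℝ), 0 < ε → ∀ η : ℝ≥0∞, 0 < η → ∀ᶠ n in atTop,
      ∃ ρ : Measure (C(ℝ≥0, F) × C(ℝ≥0, F)), ρ.fst = (P n).map (Y n) ∧ ρ.snd = P'.map Z ∧
        ρ {p | ∃ t : ℝ≥0, (t : ℝ) ≤ T ∧ ε ≤ dist (p.1 t) (p.2 t)} ≤ η) :
    TendstoInDistribution Y atTop Z P P' := by
  refine ⟨hY, hZ, ?_⟩
  set μs : ℕ → ProbabilityMeasure C(ℝ≥0, F) :=
    fun n ↦ ⟨(P n).map (Y n), Measure.isProbabilityMeasure_map (hY n)⟩ with hμs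
  set μ : ProbabilityMeasure C(ℝ≥0, F) := ⟨P'.map Z, Measure.isProbabilityMeasure_map hZ⟩ with hμ
  refine tendsto_of_forall_isClosed_limsup_le' fun G hG ↦ ?_
  -- the tube neighbourhoods of `G`
  set N : ℕ → Set C(ℝ≥0, F) := fun k ↦ tubeNhd G ((k : ℝ) + 1) (1 / ((k : ℝ) + 1)) with hNdef
  -- eventually `law(Yₙ)(G) ≤ law(Z)(N k) + η`
  have hN : ∀ (k : ℕ) (η : ℝ≥0∞), 0 < η →
      limsup (fun n ↦ (μs n).toMeasure G) atTop ≤ μ.toMeasure (N k) + η := by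
    intro k η hη
    refine limsup_le_of_le (by isBoundedDefault) ?_
    filter_upwards [hcoup ((k : ℝ) + 1) (1 / ((k : ℝ) + 1)) (by positivity) η hη] with n hn
    obtain ⟨ρ, hρ1, hρ2, hρbad⟩ := hn
    have h1 : (μs n).toMeasure G = ρ (Prod.fst ⁻¹' G) := by
      rw [show (μs n).toMeasure = ρ.fst from hρ1.symm, Measure.fst_apply hG.measurableSet]
    have h2 : μ.toMeasure (N k) = ρ (Prod.snd ⁻¹' N k) := by
      rw [show μ.toMeasure = ρ.snd from hρ2.symm, Measure.snd_apply isOpen_tubeNhd.measurableSet]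
    rw [h1, h2]
    have hsub : Prod.fst ⁻¹' G ⊆ Prod.snd ⁻¹' N k ∪
        {p | ∃ t : ℝ≥0, (t : ℝ) ≤ (k : ℝ) + 1 ∧ 1 / ((k : ℝ) + 1) ≤ dist (p.1 t) (p.2 t)} := by
      intro p hp
      by_cases hbad : ∃ t : ℝ≥0, (t : ℝ) ≤ (k : ℝ) + 1 ∧ 1 / ((k : ℝ) + 1) ≤ dist (p.1 t) (p.2 t)
      · exact Or.inr hbad
      · refine Or.inl (mem_tubeNhd.2 ⟨p.1, hp, fun t ht ↦ ?_⟩)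
        rw [dist_comm]
        exact not_le.1 fun h ↦ hbad ⟨t, ht, h⟩
    exact (measure_mono hsub).trans ((measure_union_le _ _).trans (add_le_add le_rfl hρbad))
  -- `law(Z)(N k) → law(Z)(G)`
  have hanti : Antitone N := fun k k' hkk' ↦
    tubeNhd_mono G (by simpa using hkk') (one_div_le_one_div_of_le (by positivity) (by simpa using hkk'))
  have hinter : ⋂ k : ℕ, N k = G :=
    Subset.antisymm (iInter_tubeNhd_subset hG)
      (subset_iInter fun k ↦ subset_tubeNhd G _ (by positivity))
  have hcont : Tendsto (fun k : ℕ ↦ μ.toMeasure (N k)) atTop (𝓝 (μ.toMeasure G)) := by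
    have hmeas : ∀ k, NullMeasurableSet (N k) μ.toMeasure := fun k ↦
      isOpen_tubeNhd.measurableSet.nullMeasurableSet
    have := tendsto_measure_iInter_atTop hmeas hanti ⟨0, measure_ne_top _ _⟩
    rw [hinter] at this
    exact this
  -- conclude
  refine ENNReal.le_of_forall_pos_le_add fun η hη _ ↦ ?_
  have hη' : (0 : ℝ≥0∞) < η := by exact_mod_cast hη
  exact ge_of_tendsto' (hcont.add_const (η : ℝ≥0∞)) fun k ↦ hN k η hη'

end Literature.Probability.Process
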